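import Mathlib
import HarnessLib
import Summits.AtomisticToContinuum.Crystallization.Theses.LaminarSixThreeThree

/-!
# Birth skeleton for the crux `LaminarRigidity` (route LaminarSixThreeThree, item stmt-AtomisticToContinuum-14295)

Line: **hexagon rings → per-layer triangular charts → hollow registry / Hägg word / metric assembly.**

The crux says: a GOOD laminar window (levels `c`, level index `l`, unit normal `n`, in-plane bond
length `a ∈ [19/20, 1]`, inter-layer bond length `b ∈ [19/20, 1]`, level gaps `≥ 19/25`, pairwise
separation `≥ 19/20` on `B(x i, R)`, and on `B(x i, R/2)` exactly `6 + 3 + 3` partners within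
distance `1`, each bond `ε`-sharp) is, on `B(x i, R/4)`, two-way `C(R)·ε`-matched after a rigid
motion to `barlowStacking a h s` for some Hägg word `s`.  The three stubs cut it along the
structure levels of the classical argument (Hales DSP §1.3 "12 = 6 + 3 + 3"; Harborth / Heitmann–Radin
planar rigidity; discrete Friesecke–James–Müller):

* `stub_hexagonRing` (LOCAL, planar, size M): at every site `j` with `dist (x j) (x i) ≤ 7R/16` the six
  same-level partners sit, up to `C₀ ε`, at the six vertices `x j + A (p u + q v)`, `p²+pq+q² = 1`, of a
  regular hexagon of side `a` in a frame `A` with `A e₃ = n` (angular gaps are `≥ 60° − cε` because a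
  bonded far side is `a ± ε` and an unbonded one is `> 1 ≥ a`; six gaps sum to `360°`).  Uses only the
  in-plane half of the saturation clause (count `= 6`, `a`-sharpness), levels and separation.
* `stub_layerCharts` (PROPAGATION, planar, size L): hexagon rings on `7R/16` glue, level by level, into ONE
  triangular chart per level — a frame `A k` (`A k e₃ = n`) and an origin `o k` — that two-way
  `K(R) ε`-matches the level-`k` particles on `B(x i, R/3)` (orientation consistency of neighbouring
  rings modulo the hexagonal point group; linear error growth along lattice paths; no vacancies because
  every ring is complete).  Constant: `∀ C₀, ∃ K`.
* `stub_barlowAssembly` (INTER-LAYER, size L, the 3-of-6 hollow pigeonhole + metric upgrade): given the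
  per-level charts on `R/3` and the inter-layer half of the saturation clause (counts `3 + 3`,
  `b`-sharpness), the three up-partners of a site are pairwise `≤ 1.31 < √3·19/20` apart, hence a FACE of
  the upper chart with the site under its circumcentre (`b² = a²/3 + gap²`); so consecutive charts differ
  by a hollow vector `± w` (cross-coset hollow distances `a/√3, 2a/√3` are never `a ± Kε`), one Hägg letter
  per level pair, common orientation, uniform gap `h = √(b² − a²/3)`; re-indexing the charts gives
  `barlowStacking a h s` and the two-way `K'(R) ε`-matching on `B(x i, R/4)`.  Constant: `∀ K, ∃ K'`.

`LaminarRigidity_of` is the composition (pure logic: unpack the GOOD window, split the saturation clause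
into its in-plane and inter-layer halves, chain the constants `C₀ ↦ K ↦ K'`).  Sorries live only in the
three `stub_*` theorems.  Disproof.lean for this crux: none on file at registration (no `_false_without_`
obstruction to honour yet); the separation hypothesis `≥ 19/20` on the whole `R`-window (lesson of
negatives item 3506) is carried by every stub.
-/

namespace Summit.AtomisticToContinuum.Crystallization.Cruxes.LaminarRigidity.Birth

open Literature.MathematicalPhysics.StatisticalMechanics

/-- **Stub A — hexagon rings (local planar rigidity).**  In a GOOD window, at every site `j` with
`dist (x j) (x i) ≤ 7R/16`, there is a frame `A` (linear isometry with `A e₃ = n`) such that every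
same-level partner of `j` within distance `1` is within `C₀ ε` of a hexagon vertex
`x j + A (p • u + q • v)` with `p² + pq + q² = 1` (`u = triangularVec₁ a`, `v = triangularVec₂ a`), and
every one of the six vertices has such a partner.  Why plausible: the six angular gaps at `j` are each
`≥ 60° − cε` (bonded far side `= a ± ε` by sharpness at the partner, which lies within `R/2`; unbonded far
side `> 1 ≥ a`) and sum to `360°`, so each is `60° ± 5cε`; radii are `a ± ε`, heights agree to `2ε`.
`C₀` is a universal constant.  Size M (planar trigonometry over `EuclideanSpace ℝ (Fin 3)`). -/
theorem stub_hexagonRing :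
    ∃ C₀ : ℝ, ∀ R ε : ℝ, 16 ≤ R → 0 < ε → ε ≤ 1 / 1000 → ∀ (N : ℕ) (x : Fin N → EuclideanSpace ℝ (Fin 3)) (i : Fin N) (a b : ℝ) (n : EuclideanSpace ℝ (Fin 3)) (c : ℤ → ℝ) (l : Fin N → ℤ), 19 / 20 ≤ a → a ≤ 1 → ‖n‖ = 1 → (∀ j : Fin N, dist (x j) (x i) ≤ R → |inner ℝ (x j - x i) n - c (l j)| ≤ ε) → (∀ j k : Fin N, dist (x j) (x i) ≤ R → dist (x k) (x i) ≤ R → j ≠ k → 19 / 20 ≤ dist (x j) (x k)) → (∀ j : Fin N, dist (x j) (x i) ≤ R / 2 → Nat.card {k : Fin N // k ≠ j ∧ l k = l j ∧ dist (x j) (x k) ≤ 1} = 6 ∧ ∀ k : Fin N, k ≠ j → dist (x j) (x k) ≤ 1 → l k = l j → |dist (x j) (x k) - a| ≤ ε) → (∀ j : Fin N, dist (x j) (x i) ≤ 7 * R / 16 → (∃ A : EuclideanSpace ℝ (Fin 3) →ₗᵢ[ℝ] EuclideanSpace ℝ (Fin 3), A (layerNormal 1) = n ∧ (∀ k : Fin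 N, k ≠ j → l k = l j → dist (x j) (x k) ≤ 1 → ∃ p q : ℤ, p ^ 2 + p * q + q ^ 2 = 1 ∧ dist (x k) (x j + A ((p : ℝ) • triangularVec₁ a + (q : ℝ) • triangularVec₂ a)) ≤ C₀ * ε) ∧ (∀ p q : ℤ, p ^ 2 + p * q + q ^ 2 = 1 → ∃ k : Fin N, k ≠ j ∧ l k = l j ∧ dist (x j) (x k) ≤ 1 ∧ dist (x k) (x j + A ((p : ℝ) • triangularVec₁ a + (q : ℝ) • triangularVec₂ a)) ≤ C₀ * ε))) := by
  sorry

/-- **Stub B — per-level triangular charts (planar propagation).**  If every site within `7R/16` of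
`x i` has a `C₀ ε`-hexagon ring (conclusion of Stub A), then for every level `k` there are a frame `A k`
(`A k e₃ = n`) and an origin `o k` such that on `B(x i, R/3)` the level-`k` particles are two-way
`K(R)·ε`-matched to the planar triangular lattice `o k + A k (ℤ u + ℤ v)`: every particle is near a
lattice point and every lattice point within `R/3` of `x i` is occupied.  Why plausible: neighbouring
rings share a bond and two common neighbours, so their frames agree modulo the hexagonal point group up
to `O(ε)`; errors add up along lattice paths of length `O(R)` inside the convex disc `level ∩ B(x i, R/3)`,
whose `a`-neighbourhood stays inside `7R/16`; complete rings leave no vacancy.  Levels with no particle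
within `R/3` take a far-away chart.  For `C₀ ε` not small the prover may take `K R ε ≥ 2R/3` (trivial
charts), hence `∀ C₀, ∃ K`.  Size L (discrete Friesecke–James–Müller in the plane, crude constants). -/
theorem stub_layerCharts :
    ∀ C₀ : ℝ, ∃ K : ℝ → ℝ, ∀ R ε : ℝ, 16 ≤ R → 0 < ε → ε ≤ 1 / 1000 → ∀ (N : ℕ) (x : Fin N → EuclideanSpace ℝ (Fin 3)) (i : Fin N) (a b : ℝ) (n : EuclideanSpace ℝ (Fin 3)) (c : ℤ → ℝ) (l : Fin N → ℤ), 19 / 20 ≤ a → a ≤ 1 → ‖n‖ = 1 → (∀ j : Fin N, dist (x j) (x i) ≤ R → |inner ℝ (x j - x i) n - c (l j)| ≤ ε) → (∀ j k : Fin N, dist (x j) (x i) ≤ R → dist (x k) (x i) ≤ R → j ≠ k → 19 / 20 ≤ dist (x j) (x k)) → (∀ j : Fin N, dist (x j) (x i) ≤ 7 * R / 16 → (∃ A : EuclideanSpace ℝ (Fin 3) →ₗᵢ[ℝ] EuclideanSpace ℝ (Fin 3), A (layerNormal 1) = n ∧ (∀ k : Fin N, k ≠ j → l k = l j → dist (x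 j) (x k) ≤ 1 → ∃ p q : ℤ, p ^ 2 + p * q + q ^ 2 = 1 ∧ dist (x k) (x j + A ((p : ℝ) • triangularVec₁ a + (q : ℝ) • triangularVec₂ a)) ≤ C₀ * ε) ∧ (∀ p q : ℤ, p ^ 2 + p * q + q ^ 2 = 1 → ∃ k : Fin N, k ≠ j ∧ l k = l j ∧ dist (x j) (x k) ≤ 1 ∧ dist (x k) (x j + A ((p : ℝ) • triangularVec₁ a + (q : ℝ) • triangularVec₂ a)) ≤ C₀ * ε))) → (∃ (A : ℤ → (EuclideanSpace ℝ (Fin 3) →ₗᵢ[ℝ] EuclideanSpace ℝ (Fin 3))) (o : ℤ → EuclideanSpace ℝ (Fin 3)), (∀ k : ℤ, A k (layerNormal 1) = n) ∧ (∀ j : Fin N, dist (x j) (x i) ≤ R / 3 → ∃ p q : ℤ, dist (x j) (o (l j) + A (l j) ((p : ℝ) • triangularVec₁ a + (q : ℝ) • triangularVec₂ a)) ≤ K R * ε) ∧ (∀ k p q : ℤ, dist (o k + A k ((p : ℝ) • triangularVec₁ a + (q : ℝ) • triangularVec₂ a)) (x i) ≤ R / 3 → ∃ j : Fin N, l j =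 k ∧ dist (x j) (o k + A k ((p : ℝ) • triangularVec₁ a + (q : ℝ) • triangularVec₂ a)) ≤ K R * ε)) := by
  sorry

/-- **Stub C — hollow registry, Hägg word and metric assembly (the inter-layer step).**  Given the
per-level charts of Stub B on `B(x i, R/3)` with tolerance `K(R)·ε`, the level gaps `≥ 19/25`, levels,
separation and the inter-layer half of the saturation clause (exactly three partners one level up and
three one level down within distance `1`, each at distance `b ± ε`), the window is two-way
`K'(R)·ε`-matched on `B(x i, R/4)` to `barlowStacking a h s` after a rigid motion — verbatim the
conclusion of the crux.  Why plausible: the three up-partners of a site project into a disc of radius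
`√(1.001² − 0.758²) < 0.66`, so they are pairwise `≤ 1.31 < √3 · 19/20` apart and are a FACE of the upper
chart, with the site under its circumcentre (three equal slant lengths `b ± ε`); hence chart `k+1` is
chart `k` shifted by a hollow vector `± w + (gap) n` modulo the lattice and the hexagonal point group
(cross-coset hollow distances `a/√3`, `2a/√3` are never within `Kε` of `a`), the gap is
`√(b² − a²/3) ± O(ε)` for every level pair, and the signs are a Hägg word `s`; re-index, set
`h := √(b² − a²/3)`, extend `s` by `+1` outside the window, and accumulate `O(R)` registry errors into
`K'(R)`.  For `K R ε` not small take `K' R ε ≥ R/4` (trivial matching), hence `∀ K, ∃ K'`.  Size L. -/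
theorem stub_barlowAssembly :
    ∀ K : ℝ → ℝ, ∃ K' : ℝ → ℝ, ∀ R ε : ℝ, 16 ≤ R → 0 < ε → ε ≤ 1 / 1000 → ∀ (N : ℕ) (x : Fin N → EuclideanSpace ℝ (Fin 3)) (i : Fin N) (a b : ℝ) (n : EuclideanSpace ℝ (Fin 3)) (c : ℤ → ℝ) (l : Fin N → ℤ), 19 / 20 ≤ a → a ≤ 1 → 19 / 20 ≤ b → b ≤ 1 → ‖n‖ = 1 → (∀ k : ℤ, c k + 19 / 25 ≤ c (k + 1)) → (∀ j : Fin N, dist (x j) (x i) ≤ R → |inner ℝ (x j - x i) n - c (l j)| ≤ ε) → (∀ j k : Fin N, dist (x j) (x i) ≤ R → dist (x k) (x i) ≤ R → j ≠ k → 19 / 20 ≤ dist (x j) (x k)) → (∀ j : Fin N, dist (x j) (x i) ≤ R / 2 → Nat.card {k : Fin N // l k = l j + 1 ∧ dist (x j) (x k) ≤ 1} = 3 ∧ Nat.card {k : Fin N // l k = l j - 1 ∧ dist (x j) (x k) ≤ 1} = 3 ∧ ∀ k : Fin N, k ≠ j → dist (x j) (x k) ≤ 1 → l k ≠ l j → |dist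 (x j) (x k) - b| ≤ ε) → (∃ (A : ℤ → (EuclideanSpace ℝ (Fin 3) →ₗᵢ[ℝ] EuclideanSpace ℝ (Fin 3))) (o : ℤ → EuclideanSpace ℝ (Fin 3)), (∀ k : ℤ, A k (layerNormal 1) = n) ∧ (∀ j : Fin N, dist (x j) (x i) ≤ R / 3 → ∃ p q : ℤ, dist (x j) (o (l j) + A (l j) ((p : ℝ) • triangularVec₁ a + (q : ℝ) • triangularVec₂ a)) ≤ K R * ε) ∧ (∀ k p q : ℤ, dist (o k + A k ((p : ℝ) • triangularVec₁ a + (q : ℝ) • triangularVec₂ a)) (x i) ≤ R / 3 → ∃ j : Fin N, l j = k ∧ dist (x j) (o k + A k ((p : ℝ) • triangularVec₁ a + (q : ℝ) • triangularVec₂ a)) ≤ K R * ε)) → (∃ a h : ℝ, 1 / 2 < a ∧ a < 2 ∧ 1 / 2 < h ∧ h < 2 ∧ ∃ s : ℤ → ℤ, IsHaggSeq s ∧ ∃ z ∈ barlowStacking a h s, ∃ A : EuclideanSpace ℝ (Fin 3) →ₗᵢ[ℝ] EuclideanSpace ℝ (Fin 3), (∀ p ∈ barlowStacking a h s, dist p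 z ≤ R / 4 → ∃ j : Fin N, dist (x j) (x i + A (p - z)) ≤ K' R * ε) ∧ (∀ j : Fin N, dist (x j) (x i) ≤ R / 4 → ∃ p ∈ barlowStacking a h s, dist (x j) (x i + A (p - z)) ≤ K' R * ε)) := by
  sorry

/-- **Composition with explicit hypotheses (pure logic, no `sorry`).**  The three stub STATEMENTS imply the
crux statement (spelled out: this is the body of `Summit.AtomisticToContinuum.Crystallization.Theses.LaminarSixThreeThree.LaminarRigidity` verbatim): unpack the GOOD window, split its
saturation clause into the in-plane half (for Stub A) and the inter-layer half (for Stub C), and chain the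
constants `C₀ ↦ K ↦ K' =: C`. -/
theorem LaminarRigidity_of_hyps :
    (∃ C₀ : ℝ, ∀ R ε : ℝ, 16 ≤ R → 0 < ε → ε ≤ 1 / 1000 → ∀ (N : ℕ) (x : Fin N → EuclideanSpace ℝ (Fin 3)) (i : Fin N) (a b : ℝ) (n : EuclideanSpace ℝ (Fin 3)) (c : ℤ → ℝ) (l : Fin N → ℤ), 19 / 20 ≤ a → a ≤ 1 → ‖n‖ = 1 → (∀ j : Fin N, dist (x j) (x i) ≤ R → |inner ℝ (x j - x i) n - c (l j)| ≤ ε) → (∀ j k : Fin N, dist (x j) (x i) ≤ R → dist (x k) (x i) ≤ R → j ≠ k → 19 / 20 ≤ dist (x j) (x k)) → (∀ j : Fin N, dist (x j) (x i) ≤ R / 2 → Nat.card {k : Fin N // k ≠ j ∧ l k = l j ∧ dist (x j) (x k) ≤ 1} = 6 ∧ ∀ k : Fin N, k ≠ j → dist (x j) (x k) ≤ 1 → l k = l j → |dist (x j) (x k) - a| ≤ ε) → (∀ j : Fin N, dist (x j) (x i) ≤ 7 * R / 16 → (∃ A : EuclideanSpace ℝ (Fin 3) →ₗᵢ[ℝ]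 EuclideanSpace ℝ (Fin 3), A (layerNormal 1) = n ∧ (∀ k : Fin N, k ≠ j → l k = l j → dist (x j) (x k) ≤ 1 → ∃ p q : ℤ, p ^ 2 + p * q + q ^ 2 = 1 ∧ dist (x k) (x j + A ((p : ℝ) • triangularVec₁ a + (q : ℝ) • triangularVec₂ a)) ≤ C₀ * ε) ∧ (∀ p q : ℤ, p ^ 2 + p * q + q ^ 2 = 1 → ∃ k : Fin N, k ≠ j ∧ l k = l j ∧ dist (x j) (x k) ≤ 1 ∧ dist (x k) (x j + A ((p : ℝ) • triangularVec₁ a + (q : ℝ) • triangularVec₂ a)) ≤ C₀ * ε)))) →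
    (∀ C₀ : ℝ, ∃ K : ℝ → ℝ, ∀ R ε : ℝ, 16 ≤ R → 0 < ε → ε ≤ 1 / 1000 → ∀ (N : ℕ) (x : Fin N → EuclideanSpace ℝ (Fin 3)) (i : Fin N) (a b : ℝ) (n : EuclideanSpace ℝ (Fin 3)) (c : ℤ → ℝ) (l : Fin N → ℤ), 19 / 20 ≤ a → a ≤ 1 → ‖n‖ = 1 → (∀ j : Fin N, dist (x j) (x i) ≤ R → |inner ℝ (x j - x i) n - c (l j)| ≤ ε) → (∀ j k : Fin N, dist (x j) (x i) ≤ R → dist (x k) (x i) ≤ R → j ≠ k → 19 / 20 ≤ dist (x j) (x k)) → (∀ j : Fin N, dist (x j) (x i) ≤ 7 * R / 16 → (∃ A : EuclideanSpace ℝ (Fin 3) →ₗᵢ[ℝ] EuclideanSpace ℝ (Fin 3), A (layerNormal 1) = n ∧ (∀ k : Fin N, k ≠ j → l k = l j → dist (x j) (x k) ≤ 1 → ∃ p q : ℤ, p ^ 2 + p * q + q ^ 2 = 1 ∧ dist (x k) (x j + A ((p : ℝ) • triangularVec₁ a + (q : ℝ) • triangularVec₂ a)) ≤ C₀ * ε)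 ∧ (∀ p q : ℤ, p ^ 2 + p * q + q ^ 2 = 1 → ∃ k : Fin N, k ≠ j ∧ l k = l j ∧ dist (x j) (x k) ≤ 1 ∧ dist (x k) (x j + A ((p : ℝ) • triangularVec₁ a + (q : ℝ) • triangularVec₂ a)) ≤ C₀ * ε))) → (∃ (A : ℤ → (EuclideanSpace ℝ (Fin 3) →ₗᵢ[ℝ] EuclideanSpace ℝ (Fin 3))) (o : ℤ → EuclideanSpace ℝ (Fin 3)), (∀ k : ℤ, A k (layerNormal 1) = n) ∧ (∀ j : Fin N, dist (x j) (x i) ≤ R / 3 → ∃ p q : ℤ, dist (x j) (o (l j) + A (l j) ((p : ℝ) • triangularVec₁ a + (q : ℝ) • triangularVec₂ a)) ≤ K R * ε) ∧ (∀ k p q : ℤ, dist (o k + A k ((p : ℝ) • triangularVec₁ a + (q : ℝ) • triangularVec₂ a)) (x i) ≤ R / 3 → ∃ j : Fin N, l j = k ∧ dist (x j) (o k + A k ((p : ℝ) • triangularVec₁ a + (q : ℝ) • triangularVec₂ a)) ≤ K R * ε))) →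
    (∀ K : ℝ → ℝ, ∃ K' : ℝ → ℝ, ∀ R ε : ℝ, 16 ≤ R → 0 < ε → ε ≤ 1 / 1000 → ∀ (N : ℕ) (x : Fin N → EuclideanSpace ℝ (Fin 3)) (i : Fin N) (a b : ℝ) (n : EuclideanSpace ℝ (Fin 3)) (c : ℤ → ℝ) (l : Fin N → ℤ), 19 / 20 ≤ a → a ≤ 1 → 19 / 20 ≤ b → b ≤ 1 → ‖n‖ = 1 → (∀ k : ℤ, c k + 19 / 25 ≤ c (k + 1)) → (∀ j : Fin N, dist (x j) (x i) ≤ R → |inner ℝ (x j - x i) n - c (l j)| ≤ ε) → (∀ j k : Fin N, dist (x j) (x i) ≤ R → dist (x k) (x i) ≤ R → j ≠ k → 19 / 20 ≤ dist (x j) (x k)) → (∀ j : Fin N, dist (x j) (x i) ≤ R / 2 → Nat.card {k : Fin N // l k = l j + 1 ∧ dist (x j) (x k) ≤ 1} = 3 ∧ Nat.card {k : Fin N // l k = l j - 1 ∧ dist (x j) (x k) ≤ 1} = 3 ∧ ∀ k : Fin N, k ≠ j → dist (x j) (x k) ≤ 1 → l k ≠ l j → |dist (x j) (x k) - b| ≤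 ε) → (∃ (A : ℤ → (EuclideanSpace ℝ (Fin 3) →ₗᵢ[ℝ] EuclideanSpace ℝ (Fin 3))) (o : ℤ → EuclideanSpace ℝ (Fin 3)), (∀ k : ℤ, A k (layerNormal 1) = n) ∧ (∀ j : Fin N, dist (x j) (x i) ≤ R / 3 → ∃ p q : ℤ, dist (x j) (o (l j) + A (l j) ((p : ℝ) • triangularVec₁ a + (q : ℝ) • triangularVec₂ a)) ≤ K R * ε) ∧ (∀ k p q : ℤ, dist (o k + A k ((p : ℝ) • triangularVec₁ a + (q : ℝ) • triangularVec₂ a)) (x i) ≤ R / 3 → ∃ j : Fin N, l j = k ∧ dist (x j) (o k + A k ((p : ℝ) • triangularVec₁ a + (q : ℝ) • triangularVec₂ a)) ≤ K R * ε)) → (∃ a h : ℝ, 1 / 2 < a ∧ a < 2 ∧ 1 / 2 < h ∧ h < 2 ∧ ∃ s : ℤ → ℤ, IsHaggSeq s ∧ ∃ z ∈ barlowStacking a h s, ∃ A : EuclideanSpace ℝ (Fin 3) →ₗᵢ[ℝ] EuclideanSpace ℝ (Fin 3), (∀ p ∈ barlowStacking a h s, dist p z ≤ R / 4 → ∃ j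 : Fin N, dist (x j) (x i + A (p - z)) ≤ K' R * ε) ∧ (∀ j : Fin N, dist (x j) (x i) ≤ R / 4 → ∃ p ∈ barlowStacking a h s, dist (x j) (x i + A (p - z)) ≤ K' R * ε))) →
    (∃ C : ℝ → ℝ, ∀ R ε : ℝ, 16 ≤ R → 0 < ε → ε ≤ 1 / 1000 → ∀ (N : ℕ) (x : Fin N → EuclideanSpace ℝ (Fin 3)) (i : Fin N), (∃ a b : ℝ, 19 / 20 ≤ a ∧ a ≤ 1 ∧ 19 / 20 ≤ b ∧ b ≤ 1 ∧ ∃ n : EuclideanSpace ℝ (Fin 3), ‖n‖ = 1 ∧ ∃ c : ℤ → ℝ, (∀ k : ℤ, c k + 19 / 25 ≤ c (k + 1)) ∧ ∃ l : Fin N → ℤ, (∀ j : Fin N, dist (x j) (x i) ≤ R → |inner ℝ (x j - x i) n - c (l j)| ≤ ε) ∧ (∀ j k : Fin N, dist (x j) (x i) ≤ R → dist (x k) (x i) ≤ R → j ≠ k → 19 / 20 ≤ dist (x j) (x k)) ∧ ∀ j : Fin N, dist (x j) (x i) ≤ R / 2 → Nat.card {k : Fin N // k ≠ j ∧ l k =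 l j ∧ dist (x j) (x k) ≤ 1} = 6 ∧ Nat.card {k : Fin N // l k = l j + 1 ∧ dist (x j) (x k) ≤ 1} = 3 ∧ Nat.card {k : Fin N // l k = l j - 1 ∧ dist (x j) (x k) ≤ 1} = 3 ∧ ∀ k : Fin N, k ≠ j → dist (x j) (x k) ≤ 1 → (l k = l j → |dist (x j) (x k) - a| ≤ ε) ∧ (l k ≠ l j → |dist (x j) (x k) - b| ≤ ε)) → ∃ a h : ℝ, 1 / 2 < a ∧ a < 2 ∧ 1 / 2 < h ∧ h < 2 ∧ ∃ s : ℤ → ℤ, IsHaggSeq s ∧ ∃ z ∈ barlowStacking a h s, ∃ A : EuclideanSpace ℝ (Fin 3) →ₗᵢ[ℝ] EuclideanSpace ℝ (Fin 3), (∀ p ∈ barlowStacking a h s, dist p z ≤ R / 4 → ∃ j : Fin N, dist (x j) (x i + A (p - z)) ≤ C R * ε) ∧ (∀ j : Fin N, dist (x j) (x i) ≤ R / 4 → ∃ p ∈ barlowStacking a h s, dist (x j) (x i + A (p - z)) ≤ C R * ε)) := by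
  intro hA hB hC
  obtain ⟨C₀, hA⟩ := hA
  obtain ⟨K, hB⟩ := hB C₀
  obtain ⟨K', hC⟩ := hC K
  refine ⟨K', ?_⟩
  intro R ε hR hε hε1 N x i hgood
  obtain ⟨a, b, ha, ha1, hb, hb1, n, hn, c, hc, l, hlev, hsep, hsat⟩ := hgood
  -- in-plane half of the saturation clause (Stub A) and inter-layer half (Stub C)
  have hsat6 : ∀ j : Fin N, dist (x j) (x i) ≤ R / 2 → Nat.card {k : Fin N // k ≠ j ∧ l k = l j ∧ dist (x j) (x k) ≤ 1} = 6 ∧ ∀ k : Fin N, k ≠ j → dist (x j) (x k) ≤ 1 → l k = l j → |dist (x j) (x k) - a| ≤ ε :=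
    fun j hj => ⟨(hsat j hj).1, fun k hk hd hl => ((hsat j hj).2.2.2 k hk hd).1 hl⟩
  have hsat33 : ∀ j : Fin N, dist (x j) (x i) ≤ R / 2 → Nat.card {k : Fin N // l k = l j + 1 ∧ dist (x j) (x k) ≤ 1} = 3 ∧ Nat.card {k : Fin N // l k = l j - 1 ∧ dist (x j) (x k) ≤ 1} = 3 ∧ ∀ k : Fin N, k ≠ j → dist (x j) (x k) ≤ 1 → l k ≠ l j → |dist (x j) (x k) - b| ≤ ε :=
    fun j hj => ⟨(hsat j hj).2.1, (hsat j hj).2.2.1, fun k hk hd hl => ((hsat j hj).2.2.2 k hk hd).2 hl⟩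
  have hhex : ∀ j : Fin N, dist (x j) (x i) ≤ 7 * R / 16 → (∃ A : EuclideanSpace ℝ (Fin 3) →ₗᵢ[ℝ] EuclideanSpace ℝ (Fin 3), A (layerNormal 1) = n ∧ (∀ k : Fin N, k ≠ j → l k = l j → dist (x j) (x k) ≤ 1 → ∃ p q : ℤ, p ^ 2 + p * q + q ^ 2 = 1 ∧ dist (x k) (x j + A ((p : ℝ) • triangularVec₁ a + (q : ℝ) • triangularVec₂ a)) ≤ C₀ * ε) ∧ (∀ p q : ℤ, p ^ 2 + p * q + q ^ 2 = 1 → ∃ k : Fin N, k ≠ j ∧ l k = l j ∧ dist (x j) (x k) ≤ 1 ∧ dist (x k) (x j + A ((p : ℝ) • triangularVec₁ a + (q : ℝ) • triangularVec₂ a)) ≤ C₀ * ε)) :=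
    fun j hj => hA R ε hR hε hε1 N x i a b n c l ha ha1 hn hlev hsep hsat6 j hj
  have hcharts := hB R ε hR hε hε1 N x i a b n c l ha ha1 hn hlev hsep hhex
  exact hC R ε hR hε hε1 N x i a b n c l ha ha1 hb hb1 hn hc hlev hsep hsat33 hcharts

/-- **SKELETON THEOREM — the crux `Summit.AtomisticToContinuum.Crystallization.Theses.LaminarSixThreeThree.LaminarRigidity` BY NAME from the
registered stubs** (`ledger skeleton check` shape: no hypotheses; `sorry` only inside `stub_*`). -/
theorem LaminarRigidity_of :
    Summit.AtomisticToContinuum.Crystallization.Theses.LaminarSixThreeThree.LaminarRigidity := by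
  -- the crux is a `def`; its body is the conclusion of `LaminarRigidity_of_hyps` verbatim
  unfold Summit.AtomisticToContinuum.Crystallization.Theses.LaminarSixThreeThree.LaminarRigidity
  exact LaminarRigidity_of_hyps stub_hexagonRing stub_layerCharts stub_barlowAssembly

end Summit.AtomisticToContinuum.Crystallization.Cruxes.LaminarRigidity.Birth
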